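import Summits.BirchSwinnertonDyer.BirchSwinnertonDyer.Theorems.AlignedTransportAtTwoMainConjectureOfRankZeroBSDAtTwoPointFieldCarrierCMIff
import Literature.NumberTheory.IwasawaTheory.ClassNumberPExpZeroAdjoinSqrtNegOne
import Mathlib.FieldTheory.Galois.GaloisClosure
import HarnessLib

/-!
# Route `AlignedTransportAtTwo`, crux C2 `MainConjectureOfRankZeroBSDAtTwo` (stmt-BirchSwinnertonDyer-22298):
# GALOIS BOOKKEEPING OF THE PFμ⁺ CARRIER `M = ℚ(W[2], √−1)` — `[M : ℚ] = 12`, `M/ℚ` Galois, and the `S₃`-PAIR of `Gal(M/ℚ)` inside `Gal(M/ℚ(√−1))`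

HONEST FRAMING. WIDTH-5 attached prover seat `bsd-line-att-p3` g35 on line `birth` of the lead `bsd-line-att-p2`; `--supports`
stmt-BirchSwinnertonDyer-22298, closes nothing; BSD is NOT proved; crux C2, its verdict «blocked-on `Rank1Residual.GreenbergMuConjectureIrreducible`»
and every registered stub untouched. THEOREMS ONLY (no `def`, no named fact, no `sorry`). Consumed by the sequel `…PointFieldCarrierDSixExact` (the exact
`S₃` relation `e_n(ℚ(W[2], i)) = e_n(ℚ(i, √Δ_W)) + 2·e_n(ℚ(β_j, i))`).

WHAT. `W/ℚ` elliptic, no rational `2`-torsion abscissa, `Δ_W, −Δ_W ∉ ℚ²` (so `i ∉ T = ℚ(W[2])`), `i² = −1`, `M = T ⊔ ℚ⟮i⟯` (typed as in the registered stub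
PFμ⁺), `δ = 4δ₀` (`δ² = Δ_W`), `β_j` the `2`-torsion abscissae.
* §1 degrees in `ℚ̄`: `finrank_adjoin_I_sup_adjoin_delta` (`[ℚ(i,δ):ℚ] = 4`), `finrank_adjoin_xT_sup_adjoin_I` (`[ℚ(β_j,i):ℚ] = 6`, the CM point field),
  `finrank_divisionField_two_sup_adjoin_I` (`[M:ℚ] = 12`).
* §2 `isGalois_divisionField_two_sup_adjoin_I` (compositum of Galois fields — the Mathlib instance applied EXPLICITLY: the intermediate fields of `ℚ̄/ℚ`
  carry two definitionally-but-not-reducibly equal `ℚ`-algebra structures, so instance search does not cross between them), `natCard_gal_sup_adjoin_I`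
  (`12`), the inclusions of `ℚ⟮i⟯ ≤ ℚ⟮i⟯ ⊔ ℚ⟮δ⟯`, `ℚ⟮β_j⟯ ⊔ ℚ⟮i⟯` in `M`, ★ `adjoin_xT_sup_adjoin_xT_eq_divisionField_two` (`ℚ(β_j, β_k) = T`, `j ≠ k`) and
  `adjoin_xT_sup_adjoin_I_ne` (`ℚ(β_j, i) ≠ ℚ(β_k, i)`).
* §3 ★ `exists_symmetricThree_pair_of_subfields` — flavour-free Galois lemma over ANY base `k`: `M/k` Galois of degree `12` with subfields `Q ≤ R, P, P'` of
  degrees `2, 4, 6, 6`, `P ≠ P'` ⟹ `σ, τ ∈ Gal(M/k)` with `⟨σ⟩ = Fix R`, `⟨τ⟩ = Fix P`, `σ³ = 1`, `τ² = 1`, `τσ = σ²τ`, `⟨σ,τ⟩ = Fix Q` (att-p3 g33's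
  `exists_symmetricThree_generators` inside `Fix Q`); ★★ `exists_symmetricThree_pair_sup_adjoin_I` — the carrier instance: `⟨σ⟩ = Fix ℚ(i,δ)_M`,
  `⟨τ⟩ = Fix ℚ(β_j,i)_M`, `⟨σ,τ⟩ = Fix ℚ(i)_M = Gal(M/ℚ(i))`.  The pair does NOT generate `Gal(M/ℚ) ≅ S₃ × C₂` — exactly what att-p4 g30's
  `classNumberPExp_symmetricThree_exact` allows.

References: [MilneFT2022] Ch. 3; [SilvermanAEC2009] III.§1, VIII.§1; [CaputoNuccio2020] §2; tree: att-p3 g33 `…SexticLambdaKuroda`, att-p3 g34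
`…PointFieldCarrierCM{,Iff}`, att-p4 g29 `…SexticNormRelationDescentSignFree{,AdjoinI}`, this seat's `IwasawaTheory.ClassNumberPExpZeroAdjoinSqrtNegOne`.
-/

set_option linter.dupNamespace false
set_option autoImplicit false

noncomputable section

open scoped Classical NumberField IntermediateField

namespace Summit.BirchSwinnertonDyer.BirchSwinnertonDyer.Theorems.AlignedTransportAtTwoPointFieldCarrierGalois

open NumberField Polynomial WeierstrassCurve IntermediateField Field
  Literature.NumberTheory.EllipticCurves Literature.NumberTheory.EllipticCurves.Greenberg1999
  Literature.NumberTheory.EllipticCurves.DokchitserDokchitser2012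
  Literature.NumberTheory.EllipticCurves.ZpExtension Literature.NumberTheory.GaloisRepresentations
  Literature.NumberTheory.IwasawaTheory Literature.NumberTheory.NumberFields
  Summit.BirchSwinnertonDyer.BirchSwinnertonDyer.Theorems.AlignedTransportAtTwoFineRoad.DivisionCubic
  Summit.BirchSwinnertonDyer.BirchSwinnertonDyer.Theorems.AlignedTransportAtTwoFineRoad.TowerImageDelta
  Summit.BirchSwinnertonDyer.BirchSwinnertonDyer.Theorems.AlignedTransportAtTwoCubicClosureParity
  Summit.BirchSwinnertonDyer.BirchSwinnertonDyer.Theorems.AlignedTransportAtTwoSexticTowerGrowth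
  Summit.BirchSwinnertonDyer.BirchSwinnertonDyer.Theorems.AlignedTransportAtTwoSexticNormRelationDescent
  Summit.BirchSwinnertonDyer.BirchSwinnertonDyer.Theorems.AlignedTransportAtTwoSexticNormRelationDescentSignFree
  Summit.BirchSwinnertonDyer.BirchSwinnertonDyer.Theorems.AlignedTransportAtTwoSexticNormRelationDescentSignFreeAdjoinI
  Summit.BirchSwinnertonDyer.BirchSwinnertonDyer.Theorems.AlignedTransportAtTwoSexticLambdaKuroda
  Summit.BirchSwinnertonDyer.BirchSwinnertonDyer.Theorems.AlignedTransportAtTwoPointFieldCarrierCM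
  Summit.BirchSwinnertonDyer.BirchSwinnertonDyer.Theorems.AlignedTransportAtTwoPointFieldCarrierCMIff
  Summit.BirchSwinnertonDyer.BirchSwinnertonDyer.Theorems.AlignedTransportAtTwoResolventMuUnconditional

variable (W : WeierstrassCurve ℚ) [W.IsElliptic]

/-! ## §1 Degrees inside `ℚ̄` -/

/-- **`[ℚ(i, δ) : ℚ] = 4`** (`δ = 4δ₀`, `δ² = Δ_W ∉ ℚ²`, `−Δ_W ∉ ℚ²`, `W(ℚ)[2] = 0`): the compositum of the two quadratic fields `ℚ(i) ≠ ℚ(δ)` (`i ∉ ℚ(W[2]) ⊇ ℚ(δ)`).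
[cite: SilvermanAEC2009, III.§1] -/
theorem finrank_adjoin_I_sup_adjoin_delta (ht : ∀ x : ℚ, ¬ HasRationalTwoTorsionX W x) (hsq : ¬ IsSquare W.Δ) (hnegΔ : ¬ IsSquare (-W.Δ))
    {i : AlgebraicClosure ℚ} (hi : i ^ 2 = -1) :
    Module.finrank ℚ ↥(IntermediateField.adjoin ℚ ({i} : Set (AlgebraicClosure ℚ)) ⊔ ℚ⟮4 * delta W two_ne_zero⟯) = 4 := by
  set Qi : IntermediateField ℚ (AlgebraicClosure ℚ) := IntermediateField.adjoin ℚ ({i} : Set (AlgebraicClosure ℚ)) with hQi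
  set δ : AlgebraicClosure ℚ := 4 * delta W two_ne_zero with hδdef
  have hint : IsIntegral ℚ i := by
    refine ⟨X ^ 2 + 1, monic_X_pow_add_C _ two_ne_zero, ?_⟩
    simp [hi]
  have hδint : IsIntegral ℚ δ := ((AlgebraicClosure.isAlgebraic ℚ).isAlgebraic δ).isIntegral
  haveI : FiniteDimensional ℚ ↥Qi := IntermediateField.adjoin.finiteDimensional hint
  haveI : FiniteDimensional ℚ ↥ℚ⟮δ⟯ := IntermediateField.adjoin.finiteDimensional hδint
  haveI : FiniteDimensional ℚ ↥(Qi ⊔ ℚ⟮δ⟯) := IntermediateField.finiteDimensional_sup Qi ℚ⟮δ⟯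
  have hQi2 : Module.finrank ℚ ↥Qi = 2 := finrank_adjoin_sqrt_neg_one hi
  have hK2 : Module.finrank ℚ ↥ℚ⟮δ⟯ = 2 := finrank_adjoin_eq_two_of_sq_eq (delta_mem_and_sq W).2 hsq
  have hle : Module.finrank ℚ ↥(Qi ⊔ ℚ⟮δ⟯) ≤ 4 := by
    have h := IntermediateField.finrank_sup_le Qi ℚ⟮δ⟯
    rw [hQi2, hK2] at h
    exact h
  have h2 : 2 ∣ Module.finrank ℚ ↥(Qi ⊔ ℚ⟮δ⟯) := hQi2 ▸ IntermediateField.finrank_dvd_of_le_right (le_sup_left : Qi ≤ Qi ⊔ ℚ⟮δ⟯)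
  have hpos : 0 < Module.finrank ℚ ↥(Qi ⊔ ℚ⟮δ⟯) := Module.finrank_pos
  -- `≠ 2`: otherwise `Qi = Qi ⊔ ℚ⟮δ⟯ = ℚ⟮δ⟯ ∋ i`, but `i ∉ ℚ(W[2]) ⊇ ℚ⟮δ⟯`
  have hne2 : Module.finrank ℚ ↥(Qi ⊔ ℚ⟮δ⟯) ≠ 2 := by
    intro h2eq
    have hE1 : Qi = Qi ⊔ ℚ⟮δ⟯ := IntermediateField.eq_of_le_of_finrank_eq le_sup_left (by rw [hQi2, h2eq])
    have hE2 : ℚ⟮δ⟯ = Qi ⊔ ℚ⟮δ⟯ := IntermediateField.eq_of_le_of_finrank_eq le_sup_right (by rw [hK2, h2eq])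
    have hiδ : i ∈ ℚ⟮δ⟯ := by
      rw [hE2, ← hE1]
      exact IntermediateField.mem_adjoin_simple_self ℚ i
    have hδT : ℚ⟮δ⟯ ≤ W.divisionField 2 := adjoin_simple_le_iff.mpr (delta_mem_and_sq W).1
    exact I_not_mem_divisionField_two W ht hsq hnegΔ hi (hδT hiδ)
  omega

/-- **`[ℚ(β_j, i) : ℚ] = 6`** (`W(ℚ)[2] = 0`, `i² = −1`): compositum of the cubic `ℚ(β_j)` and the quadratic `ℚ(i)` (degree divisible by `3` and `2`, at
most `6`). The CM point field of att-p3 g34. [cite: SilvermanAEC2009, III.§1 and VIII.§1] -/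
theorem finrank_adjoin_xT_sup_adjoin_I (ht : ∀ x : ℚ, ¬ HasRationalTwoTorsionX W x) {i : AlgebraicClosure ℚ} (hi : i ^ 2 = -1) (j : Fin 3) :
    Module.finrank ℚ ↥(ℚ⟮xT W two_ne_zero j⟯ ⊔ IntermediateField.adjoin ℚ ({i} : Set (AlgebraicClosure ℚ))) = 6 := by
  set Qi : IntermediateField ℚ (AlgebraicClosure ℚ) := IntermediateField.adjoin ℚ ({i} : Set (AlgebraicClosure ℚ)) with hQi
  set β : AlgebraicClosure ℚ := xT W two_ne_zero j with hβdef
  have hint : IsIntegral ℚ i := by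
    refine ⟨X ^ 2 + 1, monic_X_pow_add_C _ two_ne_zero, ?_⟩
    simp [hi]
  have hβint : IsIntegral ℚ β := ((AlgebraicClosure.isAlgebraic ℚ).isAlgebraic β).isIntegral
  haveI : FiniteDimensional ℚ ↥Qi := IntermediateField.adjoin.finiteDimensional hint
  haveI : FiniteDimensional ℚ ↥ℚ⟮β⟯ := IntermediateField.adjoin.finiteDimensional hβint
  haveI : FiniteDimensional ℚ ↥(ℚ⟮β⟯ ⊔ Qi) := IntermediateField.finiteDimensional_sup ℚ⟮β⟯ Qi
  have hQi2 : Module.finrank ℚ ↥Qi = 2 := finrank_adjoin_sqrt_neg_one hi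
  have hF3 : Module.finrank ℚ ↥ℚ⟮β⟯ = 3 := finrank_adjoin_xT_model W ht j
  have hle : Module.finrank ℚ ↥(ℚ⟮β⟯ ⊔ Qi) ≤ 6 := by
    have h := IntermediateField.finrank_sup_le ℚ⟮β⟯ Qi
    rw [hQi2, hF3] at h
    exact h
  have h3 : 3 ∣ Module.finrank ℚ ↥(ℚ⟮β⟯ ⊔ Qi) := hF3 ▸ IntermediateField.finrank_dvd_of_le_right (le_sup_left : ℚ⟮β⟯ ≤ ℚ⟮β⟯ ⊔ Qi)
  have h2 : 2 ∣ Module.finrank ℚ ↥(ℚ⟮β⟯ ⊔ Qi) := hQi2 ▸ IntermediateField.finrank_dvd_of_le_right (le_sup_right : Qi ≤ ℚ⟮β⟯ ⊔ Qi)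
  have hpos : 0 < Module.finrank ℚ ↥(ℚ⟮β⟯ ⊔ Qi) := Module.finrank_pos
  omega

/-- **`[M : ℚ] = 12` for the PFμ⁺ carrier `M = ℚ(W[2]) ⊔ ℚ⟮i⟯`** (`W(ℚ)[2] = 0`, `Δ_W, −Δ_W ∉ ℚ²`, `i² = −1`): `[T : ℚ] = 6`, `[ℚ(i,δ) : ℚ] = 4` both divide
`[M : ℚ] ≤ 12`. [cite: SilvermanAEC2009, III.§1 and VIII.§1] -/
theorem finrank_divisionField_two_sup_adjoin_I (ht : ∀ x : ℚ, ¬ HasRationalTwoTorsionX W x) (hsq : ¬ IsSquare W.Δ)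
    (hnegΔ : ¬ IsSquare (-W.Δ)) {i : AlgebraicClosure ℚ} (hi : i ^ 2 = -1) :
    Module.finrank ℚ ↥(W.divisionField 2 ⊔ IntermediateField.adjoin ℚ ({i} : Set (AlgebraicClosure ℚ))) = 12 := by
  set Qi : IntermediateField ℚ (AlgebraicClosure ℚ) := IntermediateField.adjoin ℚ ({i} : Set (AlgebraicClosure ℚ)) with hQi
  set T : IntermediateField ℚ (AlgebraicClosure ℚ) := W.divisionField 2 with hT
  set δ : AlgebraicClosure ℚ := 4 * delta W two_ne_zero with hδdef
  change Module.finrank ℚ ↥(T ⊔ Qi) = 12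
  have hint : IsIntegral ℚ i := by
    refine ⟨X ^ 2 + 1, monic_X_pow_add_C _ two_ne_zero, ?_⟩
    simp [hi]
  haveI : FiniteDimensional ℚ ↥Qi := IntermediateField.adjoin.finiteDimensional hint
  haveI : FiniteDimensional ℚ ↥(T ⊔ Qi) := IntermediateField.finiteDimensional_sup T Qi
  have hQi2 : Module.finrank ℚ ↥Qi = 2 := finrank_adjoin_sqrt_neg_one hi
  have hT6 : Module.finrank ℚ ↥T = 6 := finrank_divisionField_two_eq_six W ht hsq
  have hR4 : Module.finrank ℚ ↥(Qi ⊔ ℚ⟮δ⟯) = 4 := finrank_adjoin_I_sup_adjoin_delta W ht hsq hnegΔ hi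
  have hle : Module.finrank ℚ ↥(T ⊔ Qi) ≤ 12 := by
    have h := IntermediateField.finrank_sup_le T Qi
    rw [hQi2, hT6] at h
    exact h
  have hRle : Qi ⊔ ℚ⟮δ⟯ ≤ T ⊔ Qi :=
    sup_le le_sup_right ((adjoin_simple_le_iff.mpr (delta_mem_and_sq W).1).trans le_sup_left)
  have h6 : 6 ∣ Module.finrank ℚ ↥(T ⊔ Qi) := hT6 ▸ IntermediateField.finrank_dvd_of_le_right (le_sup_left : T ≤ T ⊔ Qi)
  have h4 : 4 ∣ Module.finrank ℚ ↥(T ⊔ Qi) := hR4 ▸ IntermediateField.finrank_dvd_of_le_right hRle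
  have hpos : 0 < Module.finrank ℚ ↥(T ⊔ Qi) := Module.finrank_pos
  omega

/-! ## §2 `M/ℚ` Galois; the subfields `ℚ⟮i⟯ ≤ ℚ⟮i⟯ ⊔ ℚ⟮δ⟯`, `ℚ⟮β_j⟯ ⊔ ℚ⟮i⟯` of `M` -/

/-- **`M = ℚ(W[2]) ⊔ ℚ⟮i⟯` is Galois over `ℚ`** (compositum of Galois fields; the Mathlib instance is applied explicitly, across the `ℚ`-algebra
diamond on subfields of `ℚ̄`). [cite: MilneFT2022, Ch. 3 (composite of Galois extensions)] -/
theorem isGalois_divisionField_two_sup_adjoin_I {i : AlgebraicClosure ℚ} (hi : i ^ 2 = -1) :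
    IsGalois ℚ ↥(W.divisionField 2 ⊔ IntermediateField.adjoin ℚ ({i} : Set (AlgebraicClosure ℚ))) :=
  @FiniteGaloisIntermediateField.instIsGaloisSubtypeMemIntermediateFieldMax ℚ (AlgebraicClosure ℚ) _ _ _ (W.divisionField 2)
    (IntermediateField.adjoin ℚ ({i} : Set (AlgebraicClosure ℚ))) (W.isGalois_divisionField 2) (isGalois_adjoin_sqrt_neg_one hi)

/-- `M = ℚ(W[2]) ⊔ ℚ⟮i⟯` is finite over `ℚ`. [cite: MilneFT2022, Ch. 3] -/
theorem finiteDimensional_divisionField_two_sup_adjoin_I {i : AlgebraicClosure ℚ} (hi : i ^ 2 = -1) :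
    FiniteDimensional ℚ ↥(W.divisionField 2 ⊔ IntermediateField.adjoin ℚ ({i} : Set (AlgebraicClosure ℚ))) := by
  have hint : IsIntegral ℚ i := by
    refine ⟨X ^ 2 + 1, monic_X_pow_add_C _ two_ne_zero, ?_⟩
    simp [hi]
  exact @IntermediateField.finiteDimensional_sup ℚ (AlgebraicClosure ℚ) _ _ _ (W.divisionField 2)
    (IntermediateField.adjoin ℚ ({i} : Set (AlgebraicClosure ℚ))) inferInstance (IntermediateField.adjoin.finiteDimensional hint)

/-- `|Gal(M/ℚ)| = 12`. [cite: SilvermanAEC2009, III.§1] -/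
theorem natCard_gal_sup_adjoin_I (ht : ∀ x : ℚ, ¬ HasRationalTwoTorsionX W x) (hsq : ¬ IsSquare W.Δ) (hnegΔ : ¬ IsSquare (-W.Δ))
    {i : AlgebraicClosure ℚ} (hi : i ^ 2 = -1) :
    Nat.card (↥(W.divisionField 2 ⊔ IntermediateField.adjoin ℚ ({i} : Set (AlgebraicClosure ℚ))) ≃ₐ[ℚ]
      ↥(W.divisionField 2 ⊔ IntermediateField.adjoin ℚ ({i} : Set (AlgebraicClosure ℚ)))) = 12 := by
  haveI := finiteDimensional_divisionField_two_sup_adjoin_I W hi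
  haveI := isGalois_divisionField_two_sup_adjoin_I W hi
  rw [IsGalois.card_aut_eq_finrank, finrank_divisionField_two_sup_adjoin_I W ht hsq hnegΔ hi]

omit [W.IsElliptic] in
/-- `ℚ⟮i⟯ ≤ ℚ(W[2]) ⊔ ℚ⟮i⟯`. -/
theorem adjoin_I_le_sup (i : AlgebraicClosure ℚ) :
    IntermediateField.adjoin ℚ ({i} : Set (AlgebraicClosure ℚ)) ≤ W.divisionField 2 ⊔ IntermediateField.adjoin ℚ ({i} : Set (AlgebraicClosure ℚ)) :=
  le_sup_right

/-- `ℚ⟮i⟯ ⊔ ℚ⟮δ⟯ ≤ ℚ(W[2]) ⊔ ℚ⟮i⟯` (`δ = 4δ₀ ∈ ℚ(W[2])`). -/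
theorem adjoin_I_sup_adjoin_delta_le_sup (i : AlgebraicClosure ℚ) :
    IntermediateField.adjoin ℚ ({i} : Set (AlgebraicClosure ℚ)) ⊔ ℚ⟮4 * delta W two_ne_zero⟯ ≤
      W.divisionField 2 ⊔ IntermediateField.adjoin ℚ ({i} : Set (AlgebraicClosure ℚ)) :=
  sup_le le_sup_right ((adjoin_simple_le_iff.mpr (delta_mem_and_sq W).1).trans le_sup_left)

/-- `ℚ⟮β_j⟯ ⊔ ℚ⟮i⟯ ≤ ℚ(W[2]) ⊔ ℚ⟮i⟯`. -/
theorem adjoin_xT_sup_adjoin_I_le_sup (i : AlgebraicClosure ℚ) (j : Fin 3) :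
    ℚ⟮xT W two_ne_zero j⟯ ⊔ IntermediateField.adjoin ℚ ({i} : Set (AlgebraicClosure ℚ)) ≤
      W.divisionField 2 ⊔ IntermediateField.adjoin ℚ ({i} : Set (AlgebraicClosure ℚ)) :=
  sup_le ((adjoin_simple_le_iff.mpr (xT_mem W j)).trans le_sup_left) le_sup_right

/-- **`ℚ⟮β_j⟯ ⊔ ℚ⟮β_k⟯ = ℚ(W[2])` for `j ≠ k`** (`W(ℚ)[2] = 0`, `Δ_W ∉ ℚ²`): the two cubic point fields are distinct inside `T` (att-p4 g29: distinct fixing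
subgroups in `Gal(T/ℚ)`), so their compositum has degree `> 3` dividing `6`. [cite: SilvermanAEC2009, III.§1 and VIII.§1] -/
theorem adjoin_xT_sup_adjoin_xT_eq_divisionField_two (ht : ∀ x : ℚ, ¬ HasRationalTwoTorsionX W x) (hsq : ¬ IsSquare W.Δ) {j k : Fin 3}
    (hjk : j ≠ k) : ℚ⟮xT W two_ne_zero j⟯ ⊔ ℚ⟮xT W two_ne_zero k⟯ = W.divisionField 2 := by
  haveI : IsGalois ℚ (W.divisionField 2) := W.isGalois_divisionField 2
  set Fj : IntermediateField ℚ ↥(W.divisionField 2) := ℚ⟮(⟨xT W two_ne_zero j, xT_mem W j⟩ : ↥(W.divisionField 2))⟯ with hFj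
  set Fk : IntermediateField ℚ ↥(W.divisionField 2) := ℚ⟮(⟨xT W two_ne_zero k, xT_mem W k⟩ : ↥(W.divisionField 2))⟯ with hFk
  have hne : Fj ≠ Fk := by
    intro h
    exact fixingSubgroup_adjoin_xT_ne_of_not_isSquare W ht hsq hjk (by rw [← hFj, ← hFk, h])
  have hFj3 : Module.finrank ℚ ↥Fj = 3 := finrank_adjoin_xT W ht j
  have hFk3 : Module.finrank ℚ ↥Fk = 3 := finrank_adjoin_xT W ht k
  have hT6 : Module.finrank ℚ ↥(W.divisionField 2) = 6 := finrank_divisionField_two_eq_six W ht hsq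
  have h3 : 3 ∣ Module.finrank ℚ ↥(Fj ⊔ Fk) := hFj3 ▸ IntermediateField.finrank_dvd_of_le_right (le_sup_left : Fj ≤ Fj ⊔ Fk)
  have hdvd : Module.finrank ℚ ↥(Fj ⊔ Fk) ∣ 6 := by
    have h := Module.finrank_mul_finrank ℚ ↥(Fj ⊔ Fk) ↥(W.divisionField 2)
    rw [hT6] at h
    exact Dvd.intro _ h
  have hne3 : Module.finrank ℚ ↥(Fj ⊔ Fk) ≠ 3 := by
    intro h3eq
    have e1 : Fj = Fj ⊔ Fk := IntermediateField.eq_of_le_of_finrank_eq le_sup_left (by rw [hFj3, h3eq])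
    have e2 : Fk = Fj ⊔ Fk := IntermediateField.eq_of_le_of_finrank_eq le_sup_right (by rw [hFk3, h3eq])
    exact hne (e1.trans e2.symm)
  have hpos : 0 < Module.finrank ℚ ↥(Fj ⊔ Fk) := Module.finrank_pos
  have h6 : Module.finrank ℚ ↥(Fj ⊔ Fk) = 6 := by
    obtain ⟨c, hc⟩ := h3
    have hc' : 3 * c ∣ 6 := hc ▸ hdvd
    have hcle : c ≤ 2 := by
      have := Nat.le_of_dvd (by norm_num) hc'
      omega
    interval_cases c <;> omega
  have htop : Fj ⊔ Fk = ⊤ :=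
    IntermediateField.eq_of_le_of_finrank_eq le_top (by rw [h6, IntermediateField.finrank_top', hT6])
  -- lift to `ℚ̄`: `lift Fj ⊔ lift Fk = lift ⊤ = T` (by `Eq.trans`, across the two `ℚ`-algebra structures on subfields of `ℚ̄`)
  have h1 : IntermediateField.lift Fj = ℚ⟮xT W two_ne_zero j⟯ :=
    IntermediateField.lift_adjoin_simple ℚ (W.divisionField 2) (⟨xT W two_ne_zero j, xT_mem W j⟩ : ↥(W.divisionField 2))
  have h2 : IntermediateField.lift Fk = ℚ⟮xT W two_ne_zero k⟯ :=
    IntermediateField.lift_adjoin_simple ℚ (W.divisionField 2) (⟨xT W two_ne_zero k, xT_mem W k⟩ : ↥(W.divisionField 2))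
  have h3' : IntermediateField.lift (Fj ⊔ Fk) = IntermediateField.lift Fj ⊔ IntermediateField.lift Fk :=
    IntermediateField.lift_sup ℚ (W.divisionField 2) Fj Fk
  have h4 : IntermediateField.lift (F := W.divisionField 2) ⊤ = W.divisionField 2 := IntermediateField.lift_top ℚ (W.divisionField 2)
  have h5 : IntermediateField.lift (Fj ⊔ Fk) = W.divisionField 2 := (congrArg IntermediateField.lift htop).trans h4
  exact ((congrArg₂ (· ⊔ ·) h1 h2).symm.trans (h3'.symm.trans h5))

/-- **`ℚ⟮β_j⟯ ⊔ ℚ⟮i⟯ ≠ ℚ⟮β_k⟯ ⊔ ℚ⟮i⟯` for `j ≠ k`** (`W(ℚ)[2] = 0`, `Δ_W, −Δ_W ∉ ℚ²`, `i² = −1`): equality would put `ℚ(W[2]) = ℚ⟮β_j⟯ ⊔ ℚ⟮β_k⟯` inside the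
degree-`6` field `ℚ(β_j, i)`, forcing `i ∈ ℚ(W[2])`. [cite: SilvermanAEC2009, III.§1] -/
theorem adjoin_xT_sup_adjoin_I_ne (ht : ∀ x : ℚ, ¬ HasRationalTwoTorsionX W x) (hsq : ¬ IsSquare W.Δ) (hnegΔ : ¬ IsSquare (-W.Δ))
    {i : AlgebraicClosure ℚ} (hi : i ^ 2 = -1) {j k : Fin 3} (hjk : j ≠ k) :
    ℚ⟮xT W two_ne_zero j⟯ ⊔ IntermediateField.adjoin ℚ ({i} : Set (AlgebraicClosure ℚ)) ≠
      ℚ⟮xT W two_ne_zero k⟯ ⊔ IntermediateField.adjoin ℚ ({i} : Set (AlgebraicClosure ℚ)) := by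
  set Qi : IntermediateField ℚ (AlgebraicClosure ℚ) := IntermediateField.adjoin ℚ ({i} : Set (AlgebraicClosure ℚ)) with hQi
  intro heq
  have hint : IsIntegral ℚ i := by
    refine ⟨X ^ 2 + 1, monic_X_pow_add_C _ two_ne_zero, ?_⟩
    simp [hi]
  haveI : FiniteDimensional ℚ ↥Qi := IntermediateField.adjoin.finiteDimensional hint
  have hβint : IsIntegral ℚ (xT W two_ne_zero j) := ((AlgebraicClosure.isAlgebraic ℚ).isAlgebraic _).isIntegral
  haveI : FiniteDimensional ℚ ↥ℚ⟮xT W two_ne_zero j⟯ := IntermediateField.adjoin.finiteDimensional hβint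
  haveI : FiniteDimensional ℚ ↥(ℚ⟮xT W two_ne_zero j⟯ ⊔ Qi) := IntermediateField.finiteDimensional_sup _ _
  have hTle : W.divisionField 2 ≤ ℚ⟮xT W two_ne_zero j⟯ ⊔ Qi := by
    have h := adjoin_xT_sup_adjoin_xT_eq_divisionField_two W ht hsq hjk
    refine h ▸ sup_le le_sup_left ?_
    exact heq ▸ (le_sup_left : ℚ⟮xT W two_ne_zero k⟯ ≤ ℚ⟮xT W two_ne_zero k⟯ ⊔ Qi)
  have hP6 : Module.finrank ℚ ↥(ℚ⟮xT W two_ne_zero j⟯ ⊔ Qi) = 6 := finrank_adjoin_xT_sup_adjoin_I W ht hi j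
  have hT6 : Module.finrank ℚ ↥(W.divisionField 2) = 6 := finrank_divisionField_two_eq_six W ht hsq
  have hTeq : W.divisionField 2 = ℚ⟮xT W two_ne_zero j⟯ ⊔ Qi := IntermediateField.eq_of_le_of_finrank_eq hTle (hT6.trans hP6.symm)
  have hiP : i ∈ ℚ⟮xT W two_ne_zero j⟯ ⊔ Qi :=
    (le_sup_right : Qi ≤ ℚ⟮xT W two_ne_zero j⟯ ⊔ Qi) (IntermediateField.mem_adjoin_simple_self ℚ i)
  have hiT : i ∈ W.divisionField 2 := hTeq ▸ hiP
  exact I_not_mem_divisionField_two W ht hsq hnegΔ hi hiT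

/-! ## §3 The `S₃`-pair inside `Gal(M/ℚ(i))` — a flavour-free Galois lemma, then the carrier -/

/-- **An `S₃`-pair from degrees, for any Galois `M/k` of degree `12`** with subfields `Q ≤ R`, `Q ≤ P`, `Q ≤ P'` of degrees `2, 4, 6, 6` over `k` and
`P ≠ P'`: there are `σ, τ ∈ Gal(M/k)` with `⟨σ⟩ = Fix R` (order `3`), `⟨τ⟩ = Fix P` (order `2`), `σ³ = 1`, `τ² = 1`, `τσ = σ²τ`, `⟨σ,τ⟩ = Fix Q`
(order `6`) — att-p3 g33's `exists_symmetricThree_generators` run inside the subgroup `Fix Q`.  Stated over an arbitrary base field `k` (the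
intermediate fields of `ℚ̄/ℚ` carry two definitionally-but-not-reducibly equal `ℚ`-algebra structures; the lemma is applied to them by `exact`).
[cite: MilneFT2022, Ch. 3 (fundamental theorem of Galois theory)] -/
theorem exists_symmetricThree_pair_of_subfields {k L : Type} [Field k] [Field L] [Algebra k L]
    {M Q R P P' : IntermediateField k L} (hQM : Q ≤ M) (hRM : R ≤ M) (hPM : P ≤ M) (hP'M : P' ≤ M)
    (hQR : Q ≤ R) (hQP : Q ≤ P) (hQP' : Q ≤ P') [FiniteDimensional k ↥M] [IsGalois k ↥M]
    (h12 : Module.finrank k ↥M = 12) (hQ2 : Module.finrank k ↥Q = 2) (hR4 : Module.finrank k ↥R = 4)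
    (hP6 : Module.finrank k ↥P = 6) (hP'6 : Module.finrank k ↥P' = 6) (hne : P ≠ P') :
    ∃ σ τ : ↥M ≃ₐ[k] ↥M,
      Subgroup.zpowers σ = (IntermediateField.restrict hRM).fixingSubgroup ∧
      Subgroup.zpowers τ = (IntermediateField.restrict hPM).fixingSubgroup ∧
      σ ^ 3 = 1 ∧ τ ^ 2 = 1 ∧ τ * σ = σ ^ 2 * τ ∧
      Subgroup.closure {σ, τ} = (IntermediateField.restrict hQM).fixingSubgroup := by
  -- `[F : k] · |Fix F_M| = [M : k]`
  have hcard : ∀ {F : IntermediateField k L} (hF : F ≤ M),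
      Module.finrank k ↥F * Nat.card ↥(IntermediateField.restrict hF).fixingSubgroup = Module.finrank k ↥M := by
    intro F hF
    rw [IsGalois.card_fixingSubgroup_eq_finrank (IntermediateField.restrict hF),
      (IntermediateField.restrict_algEquiv hF).toLinearEquiv.finrank_eq]
    exact Module.finrank_mul_finrank k ↥(IntermediateField.restrict hF) ↥M
  have hS6 : Nat.card ↥(IntermediateField.restrict hQM).fixingSubgroup = 6 := by
    have h := hcard hQM; rw [hQ2, h12] at h; omega
  have hN3 : Nat.card ↥(IntermediateField.restrict hRM).fixingSubgroup = 3 := by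
    have h := hcard hRM; rw [hR4, h12] at h; omega
  have hH2 : Nat.card ↥(IntermediateField.restrict hPM).fixingSubgroup = 2 := by
    have h := hcard hPM; rw [hP6, h12] at h; omega
  have hH'2 : Nat.card ↥(IntermediateField.restrict hP'M).fixingSubgroup = 2 := by
    have h := hcard hP'M; rw [hP'6, h12] at h; omega
  set S := (IntermediateField.restrict hQM).fixingSubgroup with hS
  set N := (IntermediateField.restrict hRM).fixingSubgroup with hN
  set H := (IntermediateField.restrict hPM).fixingSubgroup with hH
  set H' := (IntermediateField.restrict hP'M).fixingSubgroup with hH'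
  -- inclusions in `S`
  have hle : ∀ {F : IntermediateField k L} (hF : F ≤ M), Q ≤ F → (IntermediateField.restrict hF).fixingSubgroup ≤ S := by
    intro F hF hQF
    apply IntermediateField.fixingSubgroup_antitone
    intro x hx
    exact (IntermediateField.mem_restrict hF x).mpr (hQF ((IntermediateField.mem_restrict hQM x).mp hx))
  have hNS : N ≤ S := hle hRM hQR
  have hHS : H ≤ S := hle hPM hQP
  have hH'S : H' ≤ S := hle hP'M hQP'
  -- `H ≠ H'`
  have hne' : H ≠ H' := by
    intro heq
    have h1 := IsGalois.fixedField_fixingSubgroup (IntermediateField.restrict hPM)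
    have h2 := IsGalois.fixedField_fixingSubgroup (IntermediateField.restrict hP'M)
    have h3 : IntermediateField.restrict hPM = IntermediateField.restrict hP'M := by
      rw [← h1, ← h2]
      exact congrArg IntermediateField.fixedField heq
    have h4 := congrArg (IntermediateField.lift (F := M)) h3
    simp only [IntermediateField.lift_restrict] at h4
    exact hne h4
  -- the group lemma inside `S`
  have hN3' : Nat.card ↥(N.subgroupOf S) = 3 := by rw [Nat.card_congr (Subgroup.subgroupOfEquivOfLe hNS).toEquiv]; exact hN3
  have hH2' : Nat.card ↥(H.subgroupOf S) = 2 := by rw [Nat.card_congr (Subgroup.subgroupOfEquivOfLe hHS).toEquiv]; exact hH2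
  have hH2'' : Nat.card ↥(H'.subgroupOf S) = 2 := by rw [Nat.card_congr (Subgroup.subgroupOfEquivOfLe hH'S).toEquiv]; exact hH'2
  have hneS : H.subgroupOf S ≠ H'.subgroupOf S := by
    intro h
    rw [Subgroup.subgroupOf_inj, inf_eq_left.mpr hHS, inf_eq_left.mpr hH'S] at h
    exact hne' h
  haveI : Finite ↥S := Nat.finite_of_card_ne_zero (by rw [hS6]; norm_num)
  obtain ⟨σ₀, τ₀, hσN, hτH, hσ3, hτ2, hrel, hgen⟩ :=
    exists_symmetricThree_generators hS6 (N.subgroupOf S) (H.subgroupOf S) (H'.subgroupOf S) hN3' hH2' hH2'' hneS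
  refine ⟨σ₀.val, τ₀.val, ?_, ?_, ?_, ?_, ?_, ?_⟩
  · have h := congrArg (Subgroup.map S.subtype) hσN
    rw [MonoidHom.map_zpowers, Subgroup.map_subgroupOf_eq_of_le hNS] at h
    exact h
  · have h := congrArg (Subgroup.map S.subtype) hτH
    rw [MonoidHom.map_zpowers, Subgroup.map_subgroupOf_eq_of_le hHS] at h
    exact h
  · have h := congrArg S.subtype hσ3
    rw [map_pow, map_one] at h
    exact h
  · have h := congrArg S.subtype hτ2
    rw [map_pow, map_one] at h
    exact h
  · have h := congrArg S.subtype hrel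
    rw [map_mul, map_mul, map_pow] at h
    exact h
  · have h := congrArg (Subgroup.map S.subtype) hgen
    rw [MonoidHom.map_closure, Set.image_pair, ← MonoidHom.range_eq_map, Subgroup.range_subtype] at h
    exact h

/-- ★ **The `S₃`-pair of the PFμ⁺ carrier.** `W(ℚ)[2] = 0`, `Δ_W, −Δ_W ∉ ℚ²`, `i² = −1`, `M = ℚ(W[2]) ⊔ ℚ⟮i⟯`, `j : Fin 3`: there are
`σ, τ ∈ Gal(M/ℚ)` with `⟨σ⟩ = Fix(ℚ(i,δ)_M)` (order `3`), `⟨τ⟩ = Fix(ℚ(β_j,i)_M)` (order `2`), `σ³ = 1`, `τ² = 1`, `τσ = σ²τ` and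
`⟨σ, τ⟩ = Fix(ℚ(i)_M) = Gal(M/ℚ(i))` — the `S₃`-pair does NOT generate `Gal(M/ℚ) ≅ S₃ × C₂`, which is exactly what att-p4 g30's
`classNumberPExp_symmetricThree_exact` allows. [cite: MilneFT2022, Ch. 3 (fundamental theorem)] [cite: CaputoNuccio2020, §2] -/
theorem exists_symmetricThree_pair_sup_adjoin_I (ht : ∀ x : ℚ, ¬ HasRationalTwoTorsionX W x) (hsq : ¬ IsSquare W.Δ)
    (hnegΔ : ¬ IsSquare (-W.Δ)) {i : AlgebraicClosure ℚ} (hi : i ^ 2 = -1) (j : Fin 3) :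
    ∃ σ τ : ↥(W.divisionField 2 ⊔ IntermediateField.adjoin ℚ ({i} : Set (AlgebraicClosure ℚ))) ≃ₐ[ℚ]
        ↥(W.divisionField 2 ⊔ IntermediateField.adjoin ℚ ({i} : Set (AlgebraicClosure ℚ))),
      Subgroup.zpowers σ = (IntermediateField.restrict (adjoin_I_sup_adjoin_delta_le_sup W i)).fixingSubgroup ∧
      Subgroup.zpowers τ = (IntermediateField.restrict (adjoin_xT_sup_adjoin_I_le_sup W i j)).fixingSubgroup ∧
      σ ^ 3 = 1 ∧ τ ^ 2 = 1 ∧ τ * σ = σ ^ 2 * τ ∧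
      Subgroup.closure {σ, τ} = (IntermediateField.restrict (adjoin_I_le_sup W i)).fixingSubgroup := by
  have hj : j ≠ j + 1 := by fin_cases j <;> decide
  exact @exists_symmetricThree_pair_of_subfields ℚ (AlgebraicClosure ℚ) _ _ _
    (W.divisionField 2 ⊔ IntermediateField.adjoin ℚ ({i} : Set (AlgebraicClosure ℚ)))
    (IntermediateField.adjoin ℚ ({i} : Set (AlgebraicClosure ℚ)))
    (IntermediateField.adjoin ℚ ({i} : Set (AlgebraicClosure ℚ)) ⊔ ℚ⟮4 * delta W two_ne_zero⟯)
    (ℚ⟮xT W two_ne_zero j⟯ ⊔ IntermediateField.adjoin ℚ ({i} : Set (AlgebraicClosure ℚ)))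
    (ℚ⟮xT W two_ne_zero (j + 1)⟯ ⊔ IntermediateField.adjoin ℚ ({i} : Set (AlgebraicClosure ℚ)))
    (adjoin_I_le_sup W i) (adjoin_I_sup_adjoin_delta_le_sup W i) (adjoin_xT_sup_adjoin_I_le_sup W i j)
    (adjoin_xT_sup_adjoin_I_le_sup W i (j + 1)) le_sup_left le_sup_right le_sup_right
    (finiteDimensional_divisionField_two_sup_adjoin_I W hi) (isGalois_divisionField_two_sup_adjoin_I W hi)
    (finrank_divisionField_two_sup_adjoin_I W ht hsq hnegΔ hi) (finrank_adjoin_sqrt_neg_one hi)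
    (finrank_adjoin_I_sup_adjoin_delta W ht hsq hnegΔ hi) (finrank_adjoin_xT_sup_adjoin_I W ht hi j)
    (finrank_adjoin_xT_sup_adjoin_I W ht hi (j + 1)) (adjoin_xT_sup_adjoin_I_ne W ht hsq hnegΔ hi hj)


end Summit.BirchSwinnertonDyer.BirchSwinnertonDyer.Theorems.AlignedTransportAtTwoPointFieldCarrierGalois

end
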